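import Literature.AlgebraicGeometry.Motives.Uniruled
import Literature.AlgebraicGeometry.Tankeev2011.LefschetzStandardThreefoldsKodairaDimLtThree
import HarnessLib
import Literature.AlgebraicGeometry.Motives.UniruledPlurigenera

/-!
# Uniruled threefolds: the two displayed inputs of the «whole square of a uniruled threefold» row
# (cell `hodge-nonav`, sector SQ3, target (viii)(2))

PROVENANCE. Cell hodge-nonav (HUMAN RULING D-0038), planner p1 g35 (STATUS 2026-08-28T07:10:00Z target (viii), 07:24:20Z
answers A1/A2), prover seat `hodge-nonav-20241-p1` (g11). SUPPORT FILE (`--supports stmt-HodgeConjecture-19654 --as helper`).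

THE POINT. The «master square» files (`Theorems/ThreefoldSquareKunnethConverse`, `Theorems/ThreefoldSquareAllDegrees`, seat
19716-p2) take, for a smooth projective threefold `X`, the Lefschetz input in the shape
`hB : ∀ η, StandardConjectureBStar 3 X η` and — in the uniruled / `CH₀`-on-a-surface corollaries — the binder
`hW : HasChowZeroSupportedInDimLE X 2`. For a UNIRULED threefold both follow from PUBLISHED theorems:

* `B⋆(X)`: Tankeev 2011 (the tree's named fact `Tankeev2011_lefschetzStandard_threefold_kodairaDim_lt_three`, binder `¬ IsOfGeneralType 3 X`,
  i.e. `κ(X) < 3` in the tree's plurigenera-growth rendering of "general type") once one knows that a uniruled variety is NOT of general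
  type. The latter is «uniruled ⟹ all plurigenera vanish» (Debarre 2001 Cor. 4.12; Kollár 1996 IV Cor. 1.11; characteristic `0`; free
  rational curves — not in the tree, typed here as ONE cited named fact `Debarre2001_uniruled_plurigenera_eq_zero`, meant to live in
  `Literature/AlgebraicGeometry/Motives/UniruledPlurigenera`) followed by the elementary observation that a variety all of whose plurigenera
  vanish fails the growth condition `mⁿ ≤ c · P_{me}(X)` (`not_isOfGeneralType_of_plurigenera_eq_zero`, `not_isOfGeneralType_of_isUniruled`);
  hence `standardConjectureBStar_of_isUniruled_threefold`.
* `CH₀(X)` supported on a surface: the tree's `Debarre2001_uniruled_rationalCurve_through_every_point.hasChowZeroSupportedInDimLE` at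
  `n = 3` (`hasChowZeroSupportedInDimLE_two_of_isUniruled`, a re-spelling `3 − 1 = 2` for by-name consumption).

The companion input `HC22C[X] ⟸ CH₀(X) ≤ 2` is CLOSED BY POINTER (planner ruling A1): `ThreefoldTimesCurve.hc22TimesCurve_of_hasChowZeroSupportedInDimLE_two`
(file `Theorems/ThreefoldTimesCurveHodge`, :347), not restated here.

HONEST SCOPE. Two displayed published facts (Tankeev 2011; Debarre 2001 Cor. 4.12 = Kollár 1996 IV.1.11) are consumed by name, nothing is
smuggled; only the printed implication «uniruled ⟹ plurigenera vanish» is used (never its reverse). Nothing here proves the Hodge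
conjecture for a new variety; rung F-H1 not moved.

## References

* [Debarre2001] O. Debarre, Higher-Dimensional Algebraic Geometry (Universitext, 2001), Cor. 4.12 (p. 102), Remarks 4.2, 4.13.
* [Kollar1996] J. Kollár, Rational Curves on Algebraic Varieties (1996), IV Cor. 1.11.
* [Tankeev2011] S. G. Tankeev, On the standard conjecture of Lefschetz type for complex projective threefolds. II, Izv. Math. 75 (2011).
* [Fujino2020] O. Fujino, Iitaka conjecture — an introduction (2020), Definition 2.3.26, Remark 2.3.17.
-/

set_option linter.dupNamespace false

noncomputable section

open CategoryTheory AlgebraicGeometry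
open Literature.AlgebraicGeometry Literature.AlgebraicGeometry.Motives Literature.AlgebraicGeometry.HodgeTheory
open Literature.AlgebraicGeometry.Tankeev2011
open Literature.Barriers.HodgeConjecture

namespace Summit.HodgeConjecture.HodgeConjecture.Theorems.ThreefoldSquare

variable {n : ℕ} {X : SchemeOver ℂ}

/-- **A variety all of whose plurigenera vanish is not of general type** (the growth condition `mⁿ ≤ c · P_{me}(X)` of
`IsOfGeneralType` forces some `P_m(X) > 0`, `IsOfGeneralType.exists_plurigenus_pos`). [cite: Fujino2020, Definition 2.3.26 and Remark 2.3.17] -/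
theorem not_isOfGeneralType_of_plurigenera_eq_zero (hP : ∀ m : ℕ, 0 < m → plurigenus n X m = 0) :
    ¬ IsOfGeneralType n X := fun h ↦ by
  obtain ⟨m, hm, hpos⟩ := h.exists_plurigenus_pos
  rw [hP m hm] at hpos
  exact lt_irrefl 0 hpos

/-- **A smooth projective uniruled complex variety is not of general type** (`κ(X) < dim X`; in fact `κ(X) = −∞`), granted
Debarre 2001 Cor. 4.12. [cite: Debarre2001, Cor. 4.12] [cite: Kollar1996, IV Cor. 1.11] [cite: Fujino2020, Definition 2.3.26] -/
theorem not_isOfGeneralType_of_isUniruled (hD : Literature.AlgebraicGeometry.Motives.Debarre2001_uniruled_plurigenera_eq_zero)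
    (hX : IsSmoothProjective n X) (hU : IsUniruled X) : ¬ IsOfGeneralType n X :=
  not_isOfGeneralType_of_plurigenera_eq_zero (hD hX hU)

/-- **`B⋆(X)` for every uniruled smooth projective complex threefold**, granted the two published theorems Tankeev 2011 (`B(X)` for
threefolds with `κ(X) < 3`, the tree's binder `Tankeev2011_lefschetzStandard_threefold_kodairaDim_lt_three`) and Debarre 2001 Cor. 4.12
(uniruled ⟹ plurigenera vanish): in the EXACT η-binder shape of the Tankeev fact and of the master-square files
(`hB : ∀ η, StandardConjectureBStar 3 X η`; `StandardConjectureBStar` is vacuous off polarisation classes).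
[cite: Tankeev2011, main theorem] [cite: Debarre2001, Cor. 4.12] [cite: Andre1996Motifs, Prop. 1.2 (p. 11)] -/
theorem standardConjectureBStar_of_isUniruled_threefold (hT : Tankeev2011_lefschetzStandard_threefold_kodairaDim_lt_three)
    (hD : Literature.AlgebraicGeometry.Motives.Debarre2001_uniruled_plurigenera_eq_zero) (hX : IsSmoothProjective 3 X) (hU : IsUniruled X)
    (η : complexBetti X 2) : StandardConjectureBStar 3 X η :=
  hT hX (not_isOfGeneralType_of_isUniruled hD hX hU) η

/-- The same with the polarisation binder displayed (the shape `∀ η, IsPolarizationClass 3 X η → StandardConjectureBStar 3 X η`).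
[cite: Tankeev2011, main theorem] [cite: Debarre2001, Cor. 4.12] -/
theorem standardConjectureBStar_of_isUniruled_threefold' (hT : Tankeev2011_lefschetzStandard_threefold_kodairaDim_lt_three)
    (hD : Literature.AlgebraicGeometry.Motives.Debarre2001_uniruled_plurigenera_eq_zero) (hX : IsSmoothProjective 3 X) (hU : IsUniruled X)
    (η : complexBetti X 2) (_hη : IsPolarizationClass 3 X η) : StandardConjectureBStar 3 X η :=
  standardConjectureBStar_of_isUniruled_threefold hT hD hX hU η

/-- **`CH₀` of a uniruled smooth projective complex threefold is supported on a surface** (`HasChowZeroSupportedInDimLE X 2`), granted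
Debarre 2001 Remarks 4.2 (4) (the tree's named fact `Debarre2001_uniruled_rationalCurve_through_every_point` and its corollary
`.hasChowZeroSupportedInDimLE` at `n = 3`): the binder `hW` of the master-square files, by name.
[cite: Debarre2001, Remarks 4.2 (4) and Lemma 3.7] [cite: VoisinHodgeII2003, remark following Prop. 10.26 (§10.2.3)] -/
theorem hasChowZeroSupportedInDimLE_two_of_isUniruled (hDeb : Debarre2001_uniruled_rationalCurve_through_every_point)
    (hX : IsSmoothProjective 3 X) (hU : IsUniruled X) : HasChowZeroSupportedInDimLE X 2 :=
  hDeb.hasChowZeroSupportedInDimLE hX hU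

end Summit.HodgeConjecture.HodgeConjecture.Theorems.ThreefoldSquare

end
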